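import Literature.NumberTheory.Transcendental.KaehlerHodge
import Literature.NumberTheory.Transcendental.ComplexFormsHighType
import Literature.NumberTheory.Transcendental.FormIntegrationPositivity
import Literature.NumberTheory.Transcendental.FormIntegrationVolumeFormProofs

/-!
# Hodge symmetry `h^{p,q} = h^{q,p}`: reductions to the `∂̄`-Hodge theory (proofs)

This file serves the named fact
`Literature.NumberTheory.Transcendental.hodgeNumber_symm_of_isKaehlerManifold` of
`Literature/NumberTheory/Transcendental/KaehlerHodge.lean` (Hodge symmetry for a compact complex
manifold admitting *some* smooth Kähler metric, `[IsKaehlerManifold E M]`) and its metric form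
`Literature.NumberTheory.Transcendental.hodgeNumber_symm g` (same file). Everything here is
proved; no named fact is introduced.

* `hodgeNumber_symm_of_isKaehlerManifold_of_hodgeNumber_symm` — the metric-free fact follows
  from the metric form `hodgeNumber_symm g` for every smooth metric `g` (pick a smooth Kähler
  metric by `IsKaehlerManifold.exists_isKaehler`; the interim derivation preserved under the
  fact in `KaehlerHodge.lean`).
* `finrank_map_conjₛₗ` — complex conjugation of forms preserves `dim_ℂ` of subspaces;
  `hodgeNumber_eq_zero_of_finrank_real_lt` — `h^{p,q} = 0` for `p + q > dim_ℝ M`.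
* `exists_isSmoothForm_riemannianVolumeForm_of_isManifold_complex` — the **complex orientation**:
  for every smooth metric on a complex manifold some (any constant) orientation family has a
  smooth Riemannian volume form (from `isContinuousOrientation_const` and
  `isSmoothForm_riemannianVolumeForm_of_isContinuousOrientation_holds`), which discharges the
  orientation hypothesis `ho` of the Hodge-theoretic facts of `KaehlerHodge.lean`.
* `hodgeNumber_symm_of_dolbeaultHarmonicForms_conj` — **`hodgeNumber_symm g` from the two
  analytic named facts** `finrank_dolbeaultHarmonicForms_eq_hodgeNumber g o`
  (`dim ℋ^{p,q}_g = h^{p,q}`, the Hodge theorem for `∂̄`) and `dolbeaultHarmonicForms_conj g o`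
  (`\overline{ℋ^{p,q}_g} = ℋ^{q,p}_g`, from the Kähler identity `Δ_∂̄ = Δ_∂`): the conjugation
  argument of the printed proofs;
  `hodgeNumber_symm_of_isKaehlerManifold_of_dolbeaultHarmonicForms_conj` — the same for the
  metric-free fact.
* `hodgeNumber_symm_of_hodgeNumber_symm_of_isKaehlerManifold`,
  `forall_hodgeNumber_symm_iff_hodgeNumber_symm_of_isKaehlerManifold` — conversely the metric-free
  fact gives back the metric form for every smooth metric `g` (a Kähler `g` makes `M` an
  `IsKaehlerManifold`), so **at a complex manifold the two named facts are equivalent**: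
  `(∀ g, hodgeNumber_symm g) ↔ hodgeNumber_symm_of_isKaehlerManifold`. Recorded for the fact
  ledger (D-0026 review of `hodgeNumber_symm_of_isKaehlerManifold`, 2026-08-15): the two `def`s are
  one published theorem (Voisin (2002), Cor. 6.12; Huybrechts (2005), Cor. 3.2.12), of which
  `hodgeNumber_symm_of_isKaehlerManifold` is the faithful closed statement — its binders carry the
  holomorphic atlas `[IsManifold 𝓘(ℂ, E) ω M]` through `[IsKaehlerManifold E M]`, whereas the
  elaborated binders of `hodgeNumber_symm g` are only
  `[FiniteDimensional ℂ E] [IsManifold 𝓘(ℝ, E) ∞ M] (g)` (a `def` abstracts the section instances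
  its body uses; cf. the *Correction* notes of `KaehlerHodge.lean`), so that a discharge of the
  metric form should go through the class form and this equivalence rather than through a second
  corrected copy.

**Status of the discharge.** The closed theorem `hodgeNumber_symm_of_isKaehlerManifold_holds`
is *not* in this file: after the reductions above it needs exactly the discharges of the upstream
named facts `finrank_dolbeaultHarmonicForms_eq_hodgeNumber` (Voisin (2002), Thm. 5.24: elliptic
theory of `Δ_∂̄` on a compact Hermitian manifold) and `dolbeaultHarmonicForms_conj` (Voisin
(2002), Thm. 6.7: the Kähler identities), equivalently of `hodgeNumber_symm`; none of these is
discharged yet. Once they are, the discharge is the one-liner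
`hodgeNumber_symm_of_isKaehlerManifold_of_dolbeaultHarmonicForms_conj (n := finrank ℝ E)`
(with `Fact.mk rfl`) applied to the two `_holds` theorems, or
`hodgeNumber_symm_of_isKaehlerManifold_of_hodgeNumber_symm fun g ↦ hodgeNumber_symm_holds g`.

Source: C. Voisin, *Hodge Theory and Complex Algebraic Geometry I* (2002) (held; PDF pages
quoted). Cor. 6.12 (p. 121): "We have `\overline{H^{p,q}} = H^{q,p}`", proved from
`\overline{K^{p,q}} = K^{q,p}` for the spaces `K^{p,q}` of classes of closed `(p,q)`-forms
(proof of Prop. 6.11, p. 121); Lemma 6.18 (p. 122): "`H^{p,q}(X)` is canonically isomorphic to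
`H^q(X, Ω_Xᵖ)`", via `Δ_d = 2Δ_∂̄` (Thm. 6.7, p. 120) and the `Δ_∂̄`-harmonic forms (Thm. 5.24,
p. 112, the Hodge theorem for `∂̄` on a compact Hermitian manifold). Hence
`h^{p,q} = dim H^{p,q}_{∂̄} = dim ℋ^{p,q} = dim \overline{ℋ^{p,q}} = dim ℋ^{q,p} = h^{q,p}` for a
compact Kähler manifold; the metric-free statement only uses the *existence* of a Kähler metric.
D. Huybrechts, *Complex Geometry* (2005), Cor. 3.2.12 (p. 154: "`ℋ^{p,q}(X, g) ≅ ℋ^{q,p}(X, g)`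
by complex conjugation, which commutes with `Δ_∂ = Δ_∂̄`") is the same statement and proof;
Cor. 1.2.3 / Lemma 1.2.9 there: complex manifolds are canonically oriented.

## References

* C. Voisin, *Hodge Theory and Complex Algebraic Geometry I*, Cambridge Studies in Advanced
  Mathematics 76 (2002), §6.1.2 Thm. 6.7, §6.1.3 Prop. 6.11, Cor. 6.12, Lemma 6.18; §5.3.1
  Thm. 5.24.
* D. Huybrechts, *Complex Geometry. An Introduction*, Universitext (2005), Cor. 1.2.3,
  Lemma 1.2.9, Cor. 3.2.12.
* J. M. Lee, *Introduction to Smooth Manifolds* (2013), Prop. 15.6, Prop. 15.29.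
-/

noncomputable section

open scoped Manifold ContDiff
open Bundle Module

namespace Literature.NumberTheory.Transcendental

variable {E : Type*} [NormedAddCommGroup E] [NormedSpace ℂ E]
  {M : Type*} [TopologicalSpace M] [ChartedSpace E M]
  [FiniteDimensional ℂ E] [IsManifold 𝓘(ℂ, E) ω M] [IsManifold 𝓘(ℝ, E) ∞ M]

/-- **Hodge symmetry, reduction to the metric form.** The metric-free Hodge symmetry
`hodgeNumber_symm_of_isKaehlerManifold` (`h^{p,q} = h^{q,p}` for a compact complex manifold with
`[IsKaehlerManifold E M]`) follows from the metric statement `hodgeNumber_symm g` for every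
smooth metric `g` on the real tangent bundle: choose a smooth Kähler metric by
`IsKaehlerManifold.exists_isKaehler`. Voisin (2002), Cor. 6.12 (p. 121) with Lemma 6.18
(p. 122); Huybrechts (2005), Cor. 3.2.12 (p. 154). [cite: Voisin2002, Cor. 6.12] -/
theorem hodgeNumber_symm_of_isKaehlerManifold_of_hodgeNumber_symm
    (h : ∀ g : ContMDiffRiemannianMetric 𝓘(ℝ, E) ∞ E (fun x : M ↦ TangentSpace 𝓘(ℝ, E) x),
      hodgeNumber_symm g) :
    hodgeNumber_symm_of_isKaehlerManifold (E := E) (M := M) := by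
  intro _ _ _ p q
  obtain ⟨g, hg⟩ := Literature.Geometry.Kaehler.IsKaehlerManifold.exists_isKaehler (E := E) (M := M)
  exact h g hg p q

/-! ### The metric form: reduction of `hodgeNumber_symm` to the `∂̄`-harmonic facts

Voisin (2002), Cor. 6.12 / Huybrechts (2005), Cor. 3.2.12 prove Hodge symmetry by *complex
conjugation*: for a Kähler metric `Δ_∂̄ = Δ_∂` (Thm. 6.7), so `α ↦ ᾱ` is a conjugate-linear
bijection `ℋ^{p,q} ≅ ℋ^{q,p}` of `∂̄`-harmonic forms (`dolbeaultHarmonicForms_conj`), and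
`ℋ^{p,q} ≅ H^{p,q}_{∂̄}` (Thm. 5.24, `finrank_dolbeaultHarmonicForms_eq_hodgeNumber`); a
conjugate-linear bijection preserves `dim_ℂ`. The theorem
`hodgeNumber_symm_of_dolbeaultHarmonicForms_conj` below is exactly this bookkeeping, with the two
analytic named facts of `KaehlerHodge.lean` as its only hypotheses: the orientation hypothesis of
those facts is discharged by the complex orientation
(`exists_isSmoothForm_riemannianVolumeForm_of_isManifold_complex`, from
`isContinuousOrientation_const`), and degrees `p + q > dim_ℝ M` carry no forms at all
(`mform_eq_zero_of_finrank_real_lt`). -/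

section MetricForm

variable {k : ℕ}

omit [FiniteDimensional ℂ E] [IsManifold 𝓘(ℂ, E) ω M] [IsManifold 𝓘(ℝ, E) ∞ M] in
/-- `dim_ℂ` of a space of complex forms is invariant under complex conjugation: `N ↦ N̄` (the
image under the conjugate-linear involution `MForm.conjₛₗ`) preserves `finrank` (a
conjugate-linear bijection `N ≅ N̄`; Mathlib's `rank_eq_of_equiv_equiv` along `conj : ℂ → ℂ`).
Used with `N = ℋ^{p,q}`: Huybrechts (2005), Cor. 3.2.12 (proof). [folklore] -/
theorem finrank_map_conjₛₗ (N : Submodule ℂ (Literature.Geometry.Kaehler.MForm 𝓘(ℝ, E) M ℂ k)) :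
    finrank ℂ ↥(N.map (Literature.Geometry.Kaehler.MForm.conjₛₗ (E := E) (M := M) k)) =
      finrank ℂ ↥N := by
  have hinj : Function.Injective (Literature.Geometry.Kaehler.MForm.conjₛₗ (E := E) (M := M) k) := by
    intro a b hab
    have := congrArg Literature.Geometry.Kaehler.MForm.conj hab
    simpa [Literature.Geometry.Kaehler.MForm.conjₛₗ_apply,
      Literature.Geometry.Kaehler.MForm.conj_conj] using this
  let e := Submodule.equivMapOfInjective _ hinj N
  have hr := rank_eq_of_equiv_equiv (starRingEnd ℂ) e.toAddEquiv
    (Function.Involutive.bijective Complex.conj_conj) fun r m ↦ e.map_smulₛₗ r m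
  rw [Module.finrank, Module.finrank, hr]

omit [IsManifold 𝓘(ℂ, E) ω M] [IsManifold 𝓘(ℝ, E) ∞ M] in
/-- **No Hodge numbers beyond the real dimension**: `h^{p,q}(M) = 0` for `p + q > dim_ℝ E`,
since there are no non-zero `(p+q)`-forms at all (`mform_eq_zero_of_finrank_real_lt`), so
`H^{p,q}_{∂̄}(M)` is trivial. Voisin (2002), §2.3.1 (Rem. 2.24: `Ω^k_{X,ℂ} = 0` for `k > 2 dim_ℂ X`).
[cite: Voisin2002, §2.3.1] -/
theorem hodgeNumber_eq_zero_of_finrank_real_lt {p q : ℕ} (h : finrank ℝ E < p + q) :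
    hodgeNumber E M p q = 0 := by
  have hZ : Subsingleton ↥(dolbeaultClosedForms E M p q) :=
    ⟨fun a b ↦ Subtype.ext (by
      rw [mform_eq_zero_of_finrank_real_lt (a : Literature.Geometry.Kaehler.MForm 𝓘(ℝ, E) M ℂ (p + q)) h,
        mform_eq_zero_of_finrank_real_lt (b : Literature.Geometry.Kaehler.MForm 𝓘(ℝ, E) M ℂ (p + q)) h])⟩
  have hQ : Subsingleton (dolbeaultCohomology E M p q) := by
    unfold dolbeaultCohomology
    exact Submodule.Quotient.subsingleton_iff.2 (((Submodule.subsingleton_iff ℂ).2 hZ).elim _ _)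
  exact Module.finrank_zero_of_subsingleton

variable {n : ℕ} [Fact (finrank ℝ E = n)]

omit [IsManifold 𝓘(ℂ, E) ω M] [IsManifold 𝓘(ℝ, E) ∞ M] in
/-- Transport of `finrank ℋ^{p,q}` along an equality of ambient degrees (the harmonic space of
type `(q,p)` is needed both inside the `(p+q)`-forms and inside the `(q+p)`-forms). [folklore] -/
private theorem finrank_dolbeaultHarmonicForms_congr
    [RiemannianBundle (fun x : M ↦ TangentSpace 𝓘(ℝ, E) x)]
    (o : (x : M) → Orientation ℝ (TangentSpace 𝓘(ℝ, E) x) (Fin n)) {p q k k' m : ℕ}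
    (e : k = k') (h : k + m = n) (h' : k' + m = n) :
    finrank ℂ ↥(dolbeaultHarmonicForms o p q h) = finrank ℂ ↥(dolbeaultHarmonicForms o p q h') := by
  subst e
  rfl

/-- **Complex manifolds are oriented (metric form).** For every smooth Riemannian metric `g` on
the real tangent bundle of a complex manifold `M` there is an orientation family whose
Riemannian volume form is smooth: any *constant* family `x ↦ o₀` will do, since the tangent
coordinate changes of a holomorphic atlas are `ℂ`-linear with `det_ℝ = |det_ℂ|² > 0`
(`isContinuousOrientation_const`), and the volume form of a continuous orientation for a smooth
metric is smooth (`isSmoothForm_riemannianVolumeForm_of_isContinuousOrientation_holds`;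
Lee (2013), Prop. 15.29). Huybrechts (2005), Cor. 1.2.3 / Lemma 1.2.9 (complex manifolds are
canonically oriented). This supplies the orientation hypothesis `ho` of the Hodge-theoretic
facts of `KaehlerHodge.lean`. [cite: Huybrechts2005, Cor. 1.2.3] -/
theorem exists_isSmoothForm_riemannianVolumeForm_of_isManifold_complex
    (g : ContMDiffRiemannianMetric 𝓘(ℝ, E) ∞ E (fun x : M ↦ TangentSpace 𝓘(ℝ, E) x)) :
    letI : RiemannianBundle (fun x : M ↦ TangentSpace 𝓘(ℝ, E) x) := ⟨g.toRiemannianMetric⟩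
    ∃ o : (x : M) → Orientation ℝ (TangentSpace 𝓘(ℝ, E) x) (Fin n),
      Literature.Geometry.Kaehler.IsSmoothForm (Literature.Geometry.Kaehler.riemannianVolumeForm o) := by
  letI : RiemannianBundle (fun x : M ↦ TangentSpace 𝓘(ℝ, E) x) := ⟨g.toRiemannianMetric⟩
  haveI : IsContMDiffRiemannianBundle 𝓘(ℝ, E) ∞ E (fun x : M ↦ TangentSpace 𝓘(ℝ, E) x) :=
    ⟨g.inner, g.contMDiff, fun _ _ _ ↦ rfl⟩
  haveI : IsContinuousRiemannianBundle E (fun x : M ↦ TangentSpace 𝓘(ℝ, E) x) :=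
    ⟨g.inner, g.contMDiff.continuous, fun _ _ _ ↦ rfl⟩
  let o₀ : Orientation ℝ E (Fin n) := (Module.finBasisOfFinrankEq ℝ E Fact.out).orientation
  exact ⟨fun _ ↦ o₀, isSmoothForm_riemannianVolumeForm_of_isContinuousOrientation_holds _
    (isContinuousOrientation_const o₀)⟩

variable (g : ContMDiffRiemannianMetric 𝓘(ℝ, E) ∞ E (fun x : M ↦ TangentSpace 𝓘(ℝ, E) x))

/-- **Hodge symmetry from conjugation of harmonic forms** (the metric form `hodgeNumber_symm g`
reduced to the `∂̄`-Hodge theory of `KaehlerHodge.lean`). For a smooth metric `g` on the compact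
complex manifold `M`, assume: `hfin`, the Hodge theorem for `∂̄` in its numerical form
`dim_ℂ ℋ^{p,q}_g = h^{p,q}` (named fact `finrank_dolbeaultHarmonicForms_eq_hodgeNumber`; Voisin
(2002), Thm. 5.24), and `hconj`, conjugation swaps `ℋ^{p,q}_g` and `ℋ^{q,p}_g` for `g` Kähler
(named fact `dolbeaultHarmonicForms_conj`; Voisin (2002), Thm. 6.7 `Δ_∂̄ = Δ_∂`). Then
`h^{p,q} = h^{q,p}` whenever `g` is Kähler: with the complex orientation
(`exists_isSmoothForm_riemannianVolumeForm_of_isManifold_complex`), for `p + q ≤ dim_ℝ M`,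
`h^{p,q} = dim ℋ^{p,q} = dim \overline{ℋ^{p,q}} = dim ℋ^{q,p} = h^{q,p}` (`finrank_map_conjₛₗ`),
and for `p + q > dim_ℝ M` both sides vanish (`hodgeNumber_eq_zero_of_finrank_real_lt`).
Voisin (2002), Cor. 6.12 (p. 121) with Lemma 6.18 (p. 122); Huybrechts (2005), Cor. 3.2.12
(p. 154: "`ℋ^{p,q}(X, g) ≅ ℋ^{q,p}(X, g)` by complex conjugation, which commutes with
`Δ_∂ = Δ_∂̄`"). [cite: Voisin2002, Cor. 6.12] -/
theorem hodgeNumber_symm_of_dolbeaultHarmonicForms_conj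
    (hfin : ∀ (o : (x : M) → Orientation ℝ (TangentSpace 𝓘(ℝ, E) x) (Fin n)) {m : ℕ},
      finrank_dolbeaultHarmonicForms_eq_hodgeNumber g o (m := m))
    (hconj : ∀ (o : (x : M) → Orientation ℝ (TangentSpace 𝓘(ℝ, E) x) (Fin n)) {k m : ℕ},
      dolbeaultHarmonicForms_conj g o (k := k) (m := m)) :
    hodgeNumber_symm g := by
  intro _ _ hg p q
  by_cases hpq : p + q ≤ n
  · obtain ⟨m, hm⟩ : ∃ m, (p + q) + m = n := ⟨n - (p + q), by omega⟩
    have hm' : (q + p) + m = n := by omega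
    letI : RiemannianBundle (fun x : M ↦ TangentSpace 𝓘(ℝ, E) x) := ⟨g.toRiemannianMetric⟩
    obtain ⟨o, ho⟩ := exists_isSmoothForm_riemannianVolumeForm_of_isManifold_complex (n := n) g
    have h1 : finrank ℂ ↥(dolbeaultHarmonicForms o p q hm) = hodgeNumber E M p q :=
      hfin o hg.isHermitian hm ho
    have h2 : finrank ℂ ↥(dolbeaultHarmonicForms o q p hm') = hodgeNumber E M q p :=
      hfin o hg.isHermitian hm' ho
    have h3 : (dolbeaultHarmonicForms o p q hm).map (Literature.Geometry.Kaehler.MForm.conjₛₗ (p + q)) =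
        dolbeaultHarmonicForms o q p hm :=
      hconj o hg hm p q ho
    rw [← h1, ← h2, ← finrank_map_conjₛₗ (dolbeaultHarmonicForms o p q hm), h3]
    exact finrank_dolbeaultHarmonicForms_congr o (Nat.add_comm p q) hm hm'
  · have hlt : finrank ℝ E < p + q := by rw [Fact.out (p := finrank ℝ E = n)]; omega
    rw [hodgeNumber_eq_zero_of_finrank_real_lt hlt,
      hodgeNumber_eq_zero_of_finrank_real_lt (by omega)]

/-- **Hodge symmetry for `[IsKaehlerManifold E M]`, reduced to the `∂̄`-Hodge theory**: the named
fact `hodgeNumber_symm_of_isKaehlerManifold` follows from the two Hodge-theoretic named facts of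
`KaehlerHodge.lean` — `finrank_dolbeaultHarmonicForms_eq_hodgeNumber` (Voisin (2002), Thm. 5.24)
and `dolbeaultHarmonicForms_conj` (Voisin (2002), Thm. 6.7) — for all smooth metrics (and all
orientation families, at any real-dimension witness `n`), by
`hodgeNumber_symm_of_dolbeaultHarmonicForms_conj` and
`hodgeNumber_symm_of_isKaehlerManifold_of_hodgeNumber_symm`. Instantiate with
`n := finrank ℝ E`, `Fact.mk rfl`. Voisin (2002), Cor. 6.12 with Lemma 6.18; Huybrechts (2005),
Cor. 3.2.12. [cite: Voisin2002, Cor. 6.12] -/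
theorem hodgeNumber_symm_of_isKaehlerManifold_of_dolbeaultHarmonicForms_conj
    (hfin : ∀ (g : ContMDiffRiemannianMetric 𝓘(ℝ, E) ∞ E (fun x : M ↦ TangentSpace 𝓘(ℝ, E) x))
      (o : (x : M) → Orientation ℝ (TangentSpace 𝓘(ℝ, E) x) (Fin n)) {m : ℕ},
      finrank_dolbeaultHarmonicForms_eq_hodgeNumber g o (m := m))
    (hconj : ∀ (g : ContMDiffRiemannianMetric 𝓘(ℝ, E) ∞ E (fun x : M ↦ TangentSpace 𝓘(ℝ, E) x))
      (o : (x : M) → Orientation ℝ (TangentSpace 𝓘(ℝ, E) x) (Fin n)) {k m : ℕ},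
      dolbeaultHarmonicForms_conj g o (k := k) (m := m)) :
    hodgeNumber_symm_of_isKaehlerManifold (E := E) (M := M) :=
  hodgeNumber_symm_of_isKaehlerManifold_of_hodgeNumber_symm fun g ↦
    hodgeNumber_symm_of_dolbeaultHarmonicForms_conj g (hfin g) (hconj g)

end MetricForm

/-! ### The class form gives back the metric form -/

section ClassForm

/-- **Hodge symmetry, metric form from the class form.** At a complex manifold `M` the metric-free
named fact `hodgeNumber_symm_of_isKaehlerManifold` (`h^{p,q} = h^{q,p}` for compact Hausdorff `M`
with `[IsKaehlerManifold E M]`) implies the metric form `hodgeNumber_symm g` for every smooth metric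
`g` on the real tangent bundle: if `g` is Kähler, `⟨g, hg⟩` witnesses `IsKaehlerManifold E M`, and
the Hodge numbers do not mention the metric. Converse of
`hodgeNumber_symm_of_isKaehlerManifold_of_hodgeNumber_symm`. Voisin (2002), Cor. 6.12 (p. 121) with
Lemma 6.18 (p. 122); Huybrechts (2005), Cor. 3.2.12 (p. 154). [cite: Voisin2002, Cor. 6.12] -/
theorem hodgeNumber_symm_of_hodgeNumber_symm_of_isKaehlerManifold
    (h : hodgeNumber_symm_of_isKaehlerManifold (E := E) (M := M))
    (g : ContMDiffRiemannianMetric 𝓘(ℝ, E) ∞ E (fun x : M ↦ TangentSpace 𝓘(ℝ, E) x)) :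
    hodgeNumber_symm g := by
  intro _ _ hg p q
  haveI : Literature.Geometry.Kaehler.IsKaehlerManifold E M := ⟨⟨g, hg⟩⟩
  exact h p q

/-- **The two Hodge-symmetry facts are equivalent at a complex manifold**:
`(∀ g, hodgeNumber_symm g) ↔ hodgeNumber_symm_of_isKaehlerManifold` — both say that the Hodge
numbers of the compact complex manifold `M` are symmetric as soon as `M` carries a smooth Kähler
metric (`hodgeNumber_symm_of_isKaehlerManifold_of_hodgeNumber_symm` and
`hodgeNumber_symm_of_hodgeNumber_symm_of_isKaehlerManifold`). Voisin (2002), Cor. 6.12;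
Huybrechts (2005), Cor. 3.2.12. [cite: Voisin2002, Cor. 6.12] -/
theorem forall_hodgeNumber_symm_iff_hodgeNumber_symm_of_isKaehlerManifold :
    (∀ g : ContMDiffRiemannianMetric 𝓘(ℝ, E) ∞ E (fun x : M ↦ TangentSpace 𝓘(ℝ, E) x),
      hodgeNumber_symm g) ↔ hodgeNumber_symm_of_isKaehlerManifold (E := E) (M := M) :=
  ⟨hodgeNumber_symm_of_isKaehlerManifold_of_hodgeNumber_symm,
    hodgeNumber_symm_of_hodgeNumber_symm_of_isKaehlerManifold⟩

end ClassForm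

end Literature.NumberTheory.Transcendental
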